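import Summits.PneNP.PneNP.Theorems.ClusUniversalCertificateSkewKappaLeCodim
import Mathlib
import HarnessLib

/-!
# Route ClusUniversalCertificate — line `partition` on the crux `UniversalCertAll` (stmt-PneNP-19683): partition bookkeeping
(rung F-N1, cell pnp-ideate, planner p1; registered skeleton HOME/pnp-ideate-p1/lines/partition.lean sha16 3892e8c74b73aa85,
card lines/partition.md; stub 2 `stub_bookkeepingAvg` (v2, 04:26Z; v1's `stub_bookkeeping` MIN form also proved), WANTED for an
idle prover on STATUS 03:57Z)

The objects of p1's line `partition` VERBATIM (`GoodPiece`, `BookkeepingAll`, `GoodPieceAvg`, `BookkeepingAvgAll`; the skeleton declares them in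
`Summit.PneNP.PneNP.Cruxes.UniversalCertAll.Partition`, here under the Theorems namespace `…Theorems.ClusSkew` next to
`projRank` / `codimY` of `ClusUniversalCertificateSkewKappaLeCodim.lean`, p494524) and the registered stub

  `stub_bookkeepingAvg : BookkeepingAvgAll` (and the MIN form `stub_bookkeeping : BookkeepingAll`) — a partition of
  `Y ⊆ (𝔽₂^m)^n` into flats inside `Y`, each an (average-)GOOD PIECE at the origin, certifies the crux's inequality
  `Σ_{y∈Y} (n − codim_Y y) ≤ Σ_k 2^m·#{y ∈ Y : y_k = 0}`.

PROOF (the flat-partition calculus of the card, §Idea): for a flat `A` with direction `D` and a block `k` with `0 ∈ π_k(A)`,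
`#{p ∈ A : p_k = 0} = 2^{dim D − rank π_k(D)}` (`card_pts_filter`: the zero fibre is a translate of `ker (π_k|_D)`, rank–nullity
`LinearMap.finrank_range_add_finrank_ker`) and `#A = 2^{dim D}` (`card_pts`), so `#A · 2^{m − rank π_k(D)} = 2^m · #{p ∈ A : p_k = 0}`;
summing the good-piece inequality over the points of each piece and the pieces over the partition (`Finset.sum_biUnion`) gives
the claim, the unused blocks `k ∉ S` contributing nonnegative terms.

HONEST FRAMING: ONE registered M-sized stub (pure counting) of an OPEN crux of route ClusUniversalCertificate; the load-bearing
stub `stub_goodPart` (good flat partitions exist) is OPEN and XL; FRONTIER rung F-N1 — nothing here bears on P vs NP.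
-/

set_option linter.dupNamespace false -- `Summit.PneNP.PneNP.…`: summit = sub-problem name (D-0017 single-conjunct layout)

namespace Summit.PneNP.PneNP.Theorems.ClusSkew

open Finset

/-- A flat `A ⊆ Y` is a GOOD PIECE (at the origin) if for some set `S` of NEAR blocks (`0 ∈ π_k(A)` for `k ∈ S`) the
single-flat deficit `n − Σ_{k∈S} 2^{u_k(A)}` is at most the certificate codimension of every point of `A`
(p1's `GoodPiece`, verbatim). -/
def GoodPiece (n m : ℕ) (Y : Finset (Fin n → Fin m → ZMod 2)) (A : AffineSubspace (ZMod 2) (Fin n → Fin m → ZMod 2)) : Prop :=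
  ∃ S : Finset (Fin n), (∀ k ∈ S, ∃ p ∈ A, p k = 0) ∧
    ∀ y ∈ A, (n : ℤ) - ∑ k ∈ S, (2 : ℤ) ^ (m - projRank A k) ≤ (codimY m Y y : ℤ)

/-- (BK) PARTITION BOOKKEEPING: a good partition certifies the crux's inequality for that `Y` (p1's `BookkeepingAll`,
verbatim). -/
def BookkeepingAll : Prop :=
  ∀ n m : ℕ, ∀ Y : Finset (Fin n → Fin m → ZMod 2),
    ∀ parts : Finset (AffineSubspace (ZMod 2) (Fin n → Fin m → ZMod 2)),
      (∀ A ∈ parts, ∀ z ∈ A, z ∈ Y) →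
      (∀ y ∈ Y, ∃ A ∈ parts, y ∈ A) →
      (∀ A ∈ parts, ∀ B ∈ parts, A ≠ B → ∀ z ∈ A, z ∉ B) →
      (∀ A ∈ parts, GoodPiece n m Y A) →
        ∑ y ∈ Y, ((n : ℤ) - (codimY m Y y : ℤ)) ≤ ∑ k : Fin n, (2 : ℤ) ^ m * ((Y.filter fun y => y k = 0).card : ℤ)

/-- AVERAGE-good piece (the weakest per-piece condition whose sum over a partition is the crux): there are a set `S` of
NEAR blocks of `A` and the finite point set `T` of `A` with `Σ_{y ∈ T} (n − codim_Y y) ≤ |T| · Σ_{k∈S} 2^{u_k(A)}`, i.e.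
`δ(A) ≤ average_{y∈A} codim_Y(y)` (p1's `GoodPieceAvg`, verbatim; `GoodPiece` is the MIN form, min-good ⟹ avg-good). -/
def GoodPieceAvg (n m : ℕ) (Y : Finset (Fin n → Fin m → ZMod 2)) (A : AffineSubspace (ZMod 2) (Fin n → Fin m → ZMod 2)) : Prop :=
  ∃ S : Finset (Fin n), (∀ k ∈ S, ∃ p ∈ A, p k = 0) ∧
    ∃ T : Finset (Fin n → Fin m → ZMod 2), (∀ y, y ∈ T ↔ y ∈ A) ∧
      ∑ y ∈ T, ((n : ℤ) - (codimY m Y y : ℤ)) ≤ (T.card : ℤ) * ∑ k ∈ S, (2 : ℤ) ^ (m - projRank A k)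

/-- (BK-avg) Bookkeeping for the average form: an average-good flat partition of `Y` gives the certificate inequality for `Y`
(p1's `BookkeepingAvgAll`, verbatim — the registered stub 2 of the line `partition`, v2). -/
def BookkeepingAvgAll : Prop :=
  ∀ n m : ℕ, ∀ Y : Finset (Fin n → Fin m → ZMod 2),
    ∀ parts : Finset (AffineSubspace (ZMod 2) (Fin n → Fin m → ZMod 2)),
      (∀ A ∈ parts, ∀ z ∈ A, z ∈ Y) → (∀ y ∈ Y, ∃ A ∈ parts, y ∈ A) →
      (∀ A ∈ parts, ∀ B ∈ parts, A ≠ B → ∀ z ∈ A, z ∉ B) → (∀ A ∈ parts, GoodPieceAvg n m Y A) →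
        ∑ y ∈ Y, ((n : ℤ) - (codimY m Y y : ℤ)) ≤ ∑ k : Fin n, (2 : ℤ) ^ m * ((Y.filter fun y => y k = 0).card : ℤ)

/-! ## Counting the points of a flat over `𝔽₂` -/

section Counting

variable {n m : ℕ}

open Classical in
/-- The finset of points of an affine subspace of `(𝔽₂^m)^n`. -/
noncomputable def pts (A : AffineSubspace (ZMod 2) (Fin n → Fin m → ZMod 2)) : Finset (Fin n → Fin m → ZMod 2) :=
  Finset.univ.filter fun x => x ∈ A

/-- Membership in `pts A` is membership in `A`. -/
theorem mem_pts {A : AffineSubspace (ZMod 2) (Fin n → Fin m → ZMod 2)} {x : Fin n → Fin m → ZMod 2} :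
    x ∈ pts A ↔ x ∈ A := by
  simp [pts]

/-- A nonempty flat over `𝔽₂` has `2^{dim}` points. -/
theorem card_pts {A : AffineSubspace (ZMod 2) (Fin n → Fin m → ZMod 2)} {p₀ : Fin n → Fin m → ZMod 2} (hp₀ : p₀ ∈ A) :
    (pts A).card = 2 ^ Module.finrank (ZMod 2) A.direction := by
  -- the points of `A` are `p₀ + direction`
  let e : {x // x ∈ pts A} ≃ A.direction :=
    { toFun := fun x => ⟨x.1 - p₀, by
        have h := (AffineSubspace.vsub_right_mem_direction_iff_mem hp₀ x.1).mpr (mem_pts.mp x.2)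
        rwa [vsub_eq_sub] at h⟩
      invFun := fun v => ⟨v.1 + p₀, mem_pts.mpr (by
        have h := AffineSubspace.vadd_mem_of_mem_direction v.2 hp₀
        rwa [vadd_eq_add] at h)⟩
      left_inv := fun x => by simp
      right_inv := fun v => by simp }
  rw [← Nat.card_eq_finsetCard, Nat.card_congr e, Module.natCard_eq_pow_finrank (K := ZMod 2), Nat.card_zmod]

/-- In a flat over `𝔽₂` meeting `{x_k = 0}`, exactly `2^{dim − rank π_k}` points have block `k` equal to zero. -/
theorem card_pts_filter {A : AffineSubspace (ZMod 2) (Fin n → Fin m → ZMod 2)} {p₁ : Fin n → Fin m → ZMod 2}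
    (hp₁ : p₁ ∈ A) (k : Fin n) (hk : p₁ k = 0) :
    ((pts A).filter fun x => x k = 0).card = 2 ^ (Module.finrank (ZMod 2) A.direction - projRank A k) := by
  classical
  set D := A.direction with hD
  let f : D →ₗ[ZMod 2] (Fin m → ZMod 2) :=
    (LinearMap.proj k : (Fin n → Fin m → ZMod 2) →ₗ[ZMod 2] (Fin m → ZMod 2)) ∘ₗ D.subtype
  have hf : ∀ v : D, f v = (v : Fin n → Fin m → ZMod 2) k := fun v => rfl
  -- the zero fibre is `p₁ + ker f`
  let e : {x // x ∈ (pts A).filter fun x => x k = 0} ≃ LinearMap.ker f :=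
    { toFun := fun x => ⟨⟨x.1 - p₁, by
          have hx := (Finset.mem_filter.mp x.2).1
          have h := (AffineSubspace.vsub_right_mem_direction_iff_mem hp₁ x.1).mpr (mem_pts.mp hx)
          rwa [vsub_eq_sub] at h⟩, by
          have hx := (Finset.mem_filter.mp x.2).2
          rw [LinearMap.mem_ker, hf]
          change (x.1 - p₁) k = 0
          rw [Pi.sub_apply, hx, hk, sub_zero]⟩
      invFun := fun v => ⟨(v.1 : Fin n → Fin m → ZMod 2) + p₁, Finset.mem_filter.mpr ⟨mem_pts.mpr (by
          have h := AffineSubspace.vadd_mem_of_mem_direction v.1.2 hp₁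
          rwa [vadd_eq_add] at h), by
          have hv := v.2
          rw [LinearMap.mem_ker, hf] at hv
          rw [Pi.add_apply, hv, hk, add_zero]⟩⟩
      left_inv := fun x => by simp
      right_inv := fun v => by simp }
  -- rank–nullity for `f`
  have hrn := LinearMap.finrank_range_add_finrank_ker f
  have hrange : LinearMap.range f = D.map (LinearMap.proj k : (Fin n → Fin m → ZMod 2) →ₗ[ZMod 2] (Fin m → ZMod 2)) := by
    rw [LinearMap.range_comp, Submodule.range_subtype]
  have hr : Module.finrank (ZMod 2) (LinearMap.range f) = projRank A k := by
    rw [hrange]; rfl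
  have hker : Module.finrank (ZMod 2) (LinearMap.ker f) = Module.finrank (ZMod 2) D - projRank A k := by
    rw [← hr]; omega
  rw [← Nat.card_eq_finsetCard, Nat.card_congr e, Module.natCard_eq_pow_finrank (K := ZMod 2), Nat.card_zmod, hker]

/-- `#A · 2^{m − rank π_k} = 2^m · #{p ∈ A : p_k = 0}` for a block `k` met at zero (the exchange behind the bonus term). -/
theorem card_pts_mul_pow {A : AffineSubspace (ZMod 2) (Fin n → Fin m → ZMod 2)} {p₁ : Fin n → Fin m → ZMod 2}
    (hp₁ : p₁ ∈ A) (k : Fin n) (hk : p₁ k = 0) :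
    ((pts A).card : ℤ) * (2 : ℤ) ^ (m - projRank A k) = (2 : ℤ) ^ m * (((pts A).filter fun x => x k = 0).card : ℤ) := by
  rw [card_pts hp₁, card_pts_filter hp₁ k hk]
  push_cast
  rw [← pow_add, ← pow_add]
  have h1 : projRank A k ≤ m := projRank_le A k
  have h2 : projRank A k ≤ Module.finrank (ZMod 2) A.direction := by
    unfold projRank
    exact Submodule.finrank_map_le _ _
  congr 1
  omega

end Counting

/-! ## The stub -/

/-- A min-good piece is average-good. -/
theorem goodPieceAvg_of_goodPiece {n m : ℕ} (Y : Finset (Fin n → Fin m → ZMod 2))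
    (A : AffineSubspace (ZMod 2) (Fin n → Fin m → ZMod 2)) (h : GoodPiece n m Y A) : GoodPieceAvg n m Y A := by
  classical
  obtain ⟨S, hS0, hSle⟩ := h
  refine ⟨S, hS0, pts A, fun y => mem_pts, ?_⟩
  calc ∑ y ∈ pts A, ((n : ℤ) - (codimY m Y y : ℤ)) ≤ ∑ _y ∈ pts A, ∑ k ∈ S, (2 : ℤ) ^ (m - projRank A k) :=
        Finset.sum_le_sum fun y hy => by have := hSle y (mem_pts.mp hy); linarith
    _ = ((pts A).card : ℤ) * ∑ k ∈ S, (2 : ℤ) ^ (m - projRank A k) := by rw [Finset.sum_const, nsmul_eq_mul]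

/-- The per-piece inequality in the average form. -/
theorem piece_bound_avg {n m : ℕ} (Y : Finset (Fin n → Fin m → ZMod 2))
    (A : AffineSubspace (ZMod 2) (Fin n → Fin m → ZMod 2)) (hgood : GoodPieceAvg n m Y A) :
    ∑ y ∈ pts A, ((n : ℤ) - (codimY m Y y : ℤ)) ≤
      ∑ k : Fin n, (2 : ℤ) ^ m * (((pts A).filter fun y => y k = 0).card : ℤ) := by
  classical
  obtain ⟨S, hS0, T, hT, hle⟩ := hgood
  have hTA : T = pts A := Finset.ext fun y => (hT y).trans mem_pts.symm
  rw [hTA] at hle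
  refine hle.trans ?_
  rw [Finset.mul_sum]
  -- exchange `#A · 2^{m − r_k} = 2^m · #fibre` on the near blocks `k ∈ S`
  have h2 : ∀ k ∈ S, ((pts A).card : ℤ) * (2 : ℤ) ^ (m - projRank A k) =
      (2 : ℤ) ^ m * (((pts A).filter fun y => y k = 0).card : ℤ) := by
    intro k hk
    obtain ⟨p₁, hp₁, hpk⟩ := hS0 k hk
    exact card_pts_mul_pow hp₁ k hpk
  rw [Finset.sum_congr rfl h2]
  exact Finset.sum_le_sum_of_subset_of_nonneg (Finset.subset_univ S) fun k _ _ => by positivity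

/-- Assembly: per-piece bounds over a flat partition of `Y` sum to the certificate inequality. -/
theorem sum_le_of_pieces {n m : ℕ} (Y : Finset (Fin n → Fin m → ZMod 2))
    (parts : Finset (AffineSubspace (ZMod 2) (Fin n → Fin m → ZMod 2)))
    (hsub : ∀ A ∈ parts, ∀ z ∈ A, z ∈ Y) (hcov : ∀ y ∈ Y, ∃ A ∈ parts, y ∈ A)
    (hdisj : ∀ A ∈ parts, ∀ B ∈ parts, A ≠ B → ∀ z ∈ A, z ∉ B)
    (hpiece : ∀ A ∈ parts, ∑ y ∈ pts A, ((n : ℤ) - (codimY m Y y : ℤ)) ≤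
      ∑ k : Fin n, (2 : ℤ) ^ m * (((pts A).filter fun y => y k = 0).card : ℤ)) :
    ∑ y ∈ Y, ((n : ℤ) - (codimY m Y y : ℤ)) ≤ ∑ k : Fin n, (2 : ℤ) ^ m * ((Y.filter fun y => y k = 0).card : ℤ) := by
  classical
  -- `Y` is the disjoint union of the pieces
  have hY : Y = parts.biUnion pts := by
    ext y
    rw [Finset.mem_biUnion]
    constructor
    · intro hy
      obtain ⟨A, hA, hyA⟩ := hcov y hy
      exact ⟨A, hA, mem_pts.mpr hyA⟩
    · rintro ⟨A, hA, hyA⟩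
      exact hsub A hA y (mem_pts.mp hyA)
  have hpd : Set.PairwiseDisjoint (↑parts : Set (AffineSubspace (ZMod 2) (Fin n → Fin m → ZMod 2))) pts := by
    intro A hA B hB hAB
    rw [Function.onFun, Finset.disjoint_left]
    intro z hzA hzB
    exact hdisj A hA B hB hAB z (mem_pts.mp hzA) (mem_pts.mp hzB)
  have hpdk : ∀ k : Fin n, Set.PairwiseDisjoint (↑parts : Set (AffineSubspace (ZMod 2) (Fin n → Fin m → ZMod 2)))
      (fun A => (pts A).filter fun y => y k = 0) := by
    intro k A hA B hB hAB
    exact Finset.disjoint_filter_filter (hpd hA hB hAB)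
  have hpiece' := hpiece
  rw [hY, Finset.sum_biUnion hpd]
  calc ∑ A ∈ parts, ∑ y ∈ pts A, ((n : ℤ) - (codimY m (parts.biUnion pts) y : ℤ))
      ≤ ∑ A ∈ parts, ∑ k : Fin n, (2 : ℤ) ^ m * (((pts A).filter fun y => y k = 0).card : ℤ) :=
        Finset.sum_le_sum fun A hA => by rw [← hY]; exact hpiece' A hA
    _ = ∑ k : Fin n, (2 : ℤ) ^ m * ∑ A ∈ parts, (((pts A).filter fun y => y k = 0).card : ℤ) := by
        rw [Finset.sum_comm]
        refine Finset.sum_congr rfl fun k _ => ?_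
        rw [Finset.mul_sum]
    _ = ∑ k : Fin n, (2 : ℤ) ^ m * (((parts.biUnion pts).filter fun y => y k = 0).card : ℤ) := by
        refine Finset.sum_congr rfl fun k _ => ?_
        rw [Finset.filter_biUnion, Finset.card_biUnion (hpdk k)]
        push_cast
        rfl

/-- Partition bookkeeping in the MIN form (p1's original stub 2 `stub_bookkeeping : BookkeepingAll`, skeleton v1 sha16 3892e8c7):
a min-good flat partition certifies the crux's inequality. -/
theorem stub_bookkeeping : BookkeepingAll := by
  intro n m Y parts hsub hcov hdisj hgood
  exact sum_le_of_pieces Y parts hsub hcov hdisj fun A hA =>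
    piece_bound_avg Y A (goodPieceAvg_of_goodPiece Y A (hgood A hA))

/-- **Registered stub `stub_bookkeepingAvg`** of the line `partition` (stmt-PneNP-19683, v2): partition bookkeeping in the
AVERAGE form, BY NAME. -/
theorem stub_bookkeepingAvg : BookkeepingAvgAll := by
  intro n m Y parts hsub hcov hdisj hgood
  exact sum_le_of_pieces Y parts hsub hcov hdisj fun A hA => piece_bound_avg Y A (hgood A hA)

end Summit.PneNP.PneNP.Theorems.ClusSkew
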